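import Mathlib.Tactic.Group
import Literature.AnabelianGeometry.SemiGraphs.RelCosetCategories
import Literature.AlgebraicGeometry.Frobenioids.PadicFrobenioidBaseGaloisSystemCoset
import HarnessLib

/-!
# The Galois pro-system on print's relative base `𝓑^temp(Π, Π°)⁰` (small model `RelCosetCat Π°`)

Mochizuki, *The geometry of Frobenioids II*, Kyushu J. Math. **62** (2008), §1 Ex. 1.3 (i) p. 11
[cite: MochizukiFrdII2008, Ex 1.3 (i) p.11] ("`𝓑^temp(Π, Π°) ⊆ 𝓑^temp(Π)` … the full subcategory determined by the
objects that admit a morphism to the object `Π/Π°`") and §2, proof of Theorem 2.4 (ii), p. 20 l.−5 – p. 21 l. 6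
[cite: MochizukiFrdII2008, Thm 2.4 (ii) p.20] (the base of a `p`-adic Frobenioid is `D = 𝓑^temp(Π, Π°)⁰`; "by varying
the objects `Aᵢ` … `Ψ` induces … `G₁ ⥲ G₂`").  PROOF-ONLY companion of `PadicFrobenioidBaseGaloisSystemCoset` (the case
`Π° = Π`), on abc-iut-L1-t4's small model `RelCosetCat Π° = (CosetCat.admitsHomTo Π°).FullSubcategory` (universe-correct
base of `PadicFrd.Datum`).  Since `RelCosetCat Π°` is a FULL, domination-closed subcategory of `CosetCat Π` containing
every `Π/N` with `N ⊆ Π°`, everything is inherited: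

* `relCosetSystem H N hN hNH : ℕ ⥤ (RelCosetCat H)ᵒᵖ` (terms `Π/N_k`, `N_k ⊆ Π° =: H`), with
  `relCosetSystem_comp_incl : relCosetSystem … ⋙ (RelCosetCat.incl H).op = cosetSystem N hN` (definitional);
* `exists_antitone_cofinal_seq_le` — for `Π` tempered Galois-countable, a cofinal antitone sequence INSIDE `Π°`;
* `autRelCosetMulEquiv : Aut (relCosetSystem …) ≃* Aut (cosetSystem N hN)` (full faithfulness of the inclusion) and
  `toAutRelCosetMulEquiv : Π ≃* Aut (relCosetSystem …)`; `relCosetSystem_cofinal`, `relCosetSystem_torsor`;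
* straightening on the relative base: `exists_iso_relCosetSystem`, `exists_mulEquiv_aut_relCoset : Nonempty (Aut c ≃* Π)`
  for every torsor + cofinal `c : ℕ ⥤ (RelCosetCat Π°)ᵒᵖ`;
* "`Ψ^Base` induces `Π₁ ≃* Π₂`" on the relative small base: `nonempty_mulEquiv_of_relCosetCat_equivalence`,
  `exists_mulEquiv_compatible_of_relCosetCat_equivalence` ([FrdII] Thm 2.4 (ii) p. 21, base-structure half,
  universe `u`; the `CosetCat` twins live in `PadicFrobenioidPairIso`).
Constructions + theorems; no `Prop`-valued definition; nothing here bears on [IUTchIII] Cor. 3.12.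
-/

noncomputable section

namespace Literature.AlgebraicGeometry.Frobenioids

open CategoryTheory Opposite Topology Filter
open Literature.AnabelianGeometry.SemiGraphs

universe u

namespace BaseGaloisSystem

variable {G : Type u} [Group G] [TopologicalSpace G] (H : OpenSubgroup G)

/-- `Π/N` (`N ⊆ Π°`) as an object of the relative base. [cite: MochizukiFrdII2008, Ex 1.3 (i) p.11] -/
abbrev rQ (N : OpenNormalSubgroup G) (h : N.toOpenSubgroup ≤ H) : RelCosetCat H :=
  ⟨cQ N, CosetCat.admitsHomTo_of_le H h⟩

variable (N : ℕ → OpenNormalSubgroup G) (hN : Antitone N) (hNH : ∀ k, (N k).toOpenSubgroup ≤ H)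

/-- **The Galois pro-system on the relative base** `𝓑^temp(Π, Π°)⁰`: `k ↦ Π/N_k` (`N_k ⊆ Π°`), projections.
[cite: MochizukiFrdII2008, Thm 2.4 (ii) p.20] -/
def relCosetSystem : ℕ ⥤ (RelCosetCat H)ᵒᵖ where
  obj k := op (rQ H (N k) (hNH k))
  map {j k} f := (ObjectProperty.homMk (cproj (hN f.le)) : rQ H (N k) (hNH k) ⟶ rQ H (N j) (hNH j)).op
  map_id k := by
    apply Quiver.Hom.unop_inj
    apply ObjectProperty.hom_ext
    change cproj (hN le_rfl) = 𝟙 (cQ (N k))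
    exact cproj_self (N k) _
  map_comp {i j k} f g := by
    apply Quiver.Hom.unop_inj
    apply ObjectProperty.hom_ext
    change cproj (hN (f ≫ g).le) = cproj (hN g.le) ≫ cproj (hN f.le)
    exact (cproj_comp _ _).symm

/-- Terms of the relative system. [cite: MochizukiFrdII2008, Thm 2.4 (ii) p.20] -/
@[simp] theorem relCosetSystem_obj (k : ℕ) : (relCosetSystem H N hN hNH).obj k = op (rQ H (N k) (hNH k)) := rfl

/-- **The relative system IS the coset system under the inclusion** `RelCosetCat Π° ⥤ CosetCat Π` (definitionally).
[cite: MochizukiFrdII2008, Ex 1.3 (i) p.11] -/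
theorem relCosetSystem_comp_incl : relCosetSystem H N hN hNH ⋙ (RelCosetCat.incl H).op = cosetSystem N hN := rfl

/-- **`Aut` is unchanged by passing to the relative base** (the inclusion is fully faithful, hence so is whiskering by
it). [cite: MochizukiFrdII2008, Ex 1.3 (i) p.11] -/
def autRelCosetMulEquiv : Aut (relCosetSystem H N hN hNH) ≃* Aut (cosetSystem N hN) :=
  ((Functor.FullyFaithful.ofFullyFaithful (RelCosetCat.incl H).op).whiskeringRight ℕ).autMulEquivOfFullyFaithful
    (relCosetSystem H N hN hNH)

/-- Components: `autRelCosetMulEquiv` forgets the relative structure. [cite: MochizukiFrdII2008, Ex 1.3 (i) p.11] -/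
theorem autRelCosetMulEquiv_hom_app (σ : Aut (relCosetSystem H N hN hNH)) (k : ℕ) :
    ((autRelCosetMulEquiv H N hN hNH σ).hom.app k).unop = ((σ.hom.app k).unop).hom := rfl

/-- **Cofinality** on the relative base (every `Π/U` of `𝓑^temp(Π, Π°)⁰` receives a morphism from some `Π/N_k`).
[cite: MochizukiFrdII2008, Thm 2.4 (ii) p.20] -/
theorem relCosetSystem_cofinal (hNb : ∀ U ∈ 𝓝 (1 : G), ∃ k, (N k : Set G) ⊆ U) (X : RelCosetCat H) :
    ∃ k, Nonempty (((relCosetSystem H N hN hNH).obj k).unop ⟶ X) := by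
  obtain ⟨k, ⟨f⟩⟩ := cosetSystem_cofinal N hN hNb X.obj
  exact ⟨k, ⟨ObjectProperty.homMk f⟩⟩

/-- The terms of the relative system are Galois (torsor form) in `𝓑^temp(Π, Π°)⁰`. [cite: MochizukiSemiAnbd2006, Rmk 3.1.3 p.34] -/
theorem relCosetSystem_torsor (k : ℕ) (S : RelCosetCat H) (ψ₁ ψ₂ : S ⟶ ((relCosetSystem H N hN hNH).obj k).unop) :
    ∃ α : Aut ((relCosetSystem H N hN hNH).obj k).unop, ψ₁ = ψ₂ ≫ α.hom := by
  obtain ⟨α, hα⟩ := cQ_torsor (N k) S.obj ψ₁.hom ψ₂.hom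
  exact ⟨ObjectProperty.isoMk (C := CosetCat G) (P := CosetCat.admitsHomTo H) α, ObjectProperty.hom_ext _ hα⟩

variable [IsTopologicalGroup G] (hG : IsTempered G)

include hG in
/-- For `Π` tempered and Galois-countable there is a cofinal antitone sequence of open normal subgroups INSIDE `Π°`.
[cite: MochizukiSemiAnbd2006, Rmk 3.1.2 p.33] -/
theorem exists_antitone_cofinal_seq_le [SecondCountableTopology G] :
    ∃ N : ℕ → OpenNormalSubgroup G, Antitone N ∧ (∀ U ∈ 𝓝 (1 : G), ∃ k, (N k : Set G) ⊆ U) ∧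
      ∀ k, (N k).toOpenSubgroup ≤ H := by
  obtain ⟨N, hN, hNb⟩ := exists_antitone_cofinal_seq hG
  obtain ⟨M, -, hMH⟩ := hG.basis (H : Set G) H.mem_nhds_one
  refine ⟨fun k => N k ⊓ M, fun j k hjk => inf_le_inf_right M (hN hjk), fun U hU => ?_,
    fun k x hx => hMH (show x ∈ N k ∧ x ∈ M from hx).2⟩
  obtain ⟨k, hk⟩ := hNb U hU
  exact ⟨k, fun x hx => hk (show x ∈ N k ∧ x ∈ M from hx).1⟩

/-- **`Π ≃* Aut` of the Galois pro-system on the relative base** (cofinal case). [cite: MochizukiSemiAnbd2006, Rmk 3.2.1 p.35] -/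
def toAutRelCosetMulEquiv (hNb : ∀ U ∈ 𝓝 (1 : G), ∃ k, (N k : Set G) ⊆ U) :
    G ≃* Aut (relCosetSystem H N hN hNH) :=
  (toAutCosetMulEquiv N hN hG hNb).trans (autRelCosetMulEquiv H N hN hNH).symm

omit [IsTopologicalGroup G] in
/-- **Action formula** on the relative base: the `k`-th component of `toAutRelCosetMulEquiv g` is right translation by
`g` on `Π/N_k`. [cite: MochizukiFrdII2008, Thm 2.4 (ii) p.21] -/
theorem toAutRelCosetMulEquiv_hom_app (hNb : ∀ U ∈ 𝓝 (1 : G), ∃ k, (N k : Set G) ⊆ U) (g : G) (k : ℕ) :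
    (((toAutRelCosetMulEquiv H N hN hNH hG hNb g).hom.app k).unop).hom = crightMul (N k) g := by
  have h := MulEquiv.apply_symm_apply (autRelCosetMulEquiv H N hN hNH) (toAutCoset N hN g)
  have h' := congrArg (fun σ : Aut (cosetSystem N hN) => (σ.hom.app k).unop) h
  exact h'

include hG in
/-- **Straightening on the relative base.**  Every `c : ℕ ⥤ (RelCosetCat Π°)ᵒᵖ` with Galois (torsor) terms which is
cofinal in `𝓑^temp(Π, Π°)⁰` is isomorphic to `relCosetSystem H N hN hNH` for some cofinal antitone `N ⊆ Π°`.
[cite: MochizukiFrdII2008, Thm 2.4 (ii) p.21] -/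
theorem exists_iso_relCosetSystem (c : ℕ ⥤ (RelCosetCat H)ᵒᵖ)
    (htor : ∀ (k : ℕ) (S : RelCosetCat H) (ψ₁ ψ₂ : S ⟶ (c.obj k).unop), ∃ α : Aut (c.obj k).unop, ψ₁ = ψ₂ ≫ α.hom)
    (hcof : ∀ X : RelCosetCat H, ∃ k, Nonempty ((c.obj k).unop ⟶ X)) :
    ∃ (N : ℕ → OpenNormalSubgroup G) (hN : Antitone N) (hNH : ∀ k, (N k).toOpenSubgroup ≤ H),
      (∀ U ∈ 𝓝 (1 : G), ∃ k, (N k : Set G) ⊆ U) ∧ Nonempty (c ≅ relCosetSystem H N hN hNH) := by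
  -- the underlying system in `CosetCat Π` is torsor + cofinal
  let c' : ℕ ⥤ (CosetCat G)ᵒᵖ := c ⋙ (RelCosetCat.incl H).op
  have htor' : ∀ (k : ℕ) (S : CosetCat G) (ψ₁ ψ₂ : S ⟶ (c'.obj k).unop),
      ∃ α : Aut (c'.obj k).unop, ψ₁ = ψ₂ ≫ α.hom := by
    intro k S ψ₁ ψ₂
    -- `S` maps to an object of the relative base, hence lies in it (domination-closed)
    let S' : RelCosetCat H := ⟨S, CosetCat.admitsHomTo_of_hom H ψ₁ (c.obj k).unop.property⟩
    obtain ⟨α, hα⟩ := htor k S' (ObjectProperty.homMk ψ₁) (ObjectProperty.homMk ψ₂)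
    exact ⟨(CosetCat.admitsHomTo H).ι.mapIso α, congrArg InducedCategory.Hom.hom hα⟩
  have hcof' : ∀ X : CosetCat G, ∃ k, Nonempty ((c'.obj k).unop ⟶ X) := by
    intro X
    -- through `Π/(U ∩ Π°)`, an object of the relative base mapping to `Π/U`
    let X' : RelCosetCat H := ⟨⟨X.sg ⊓ H⟩, CosetCat.admitsHomTo_of_le H inf_le_right⟩
    obtain ⟨k, ⟨f⟩⟩ := hcof X'
    refine ⟨k, ⟨f.hom ≫ CosetCat.homMk ((1 : G) : X.carrier) fun u hu => ?_⟩⟩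
    exact (CosetCat.smul_one_eq_one_iff X u).mpr (show u ∈ X.sg ∧ u ∈ H from hu).1
  obtain ⟨N, hN, hNb, ⟨ι⟩⟩ := exists_iso_cosetSystem hG c' htor' hcof'
  -- the straightened subgroups lie in `Π°`: `Π/N_k ≅ c_k` admits a morphism to `Π/Π°`, and `N_k` is normal
  have hNH : ∀ k, (N k).toOpenSubgroup ≤ H := by
    intro k x hx
    have hadm : CosetCat.admitsHomTo H (cQ (N k)) :=
      CosetCat.admitsHomTo_of_hom H (ι.app k).unop.hom (c.obj k).unop.property
    obtain ⟨g, hg⟩ := (CosetCat.admitsHomTo_iff H _).mp hadm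
    have h1 := hg (g * x * g⁻¹) ((N k).isNormal'.conj_mem x hx g)
    have h2 : g⁻¹ * (g * x * g⁻¹) * g = x := by group
    rwa [h2] at h1
  refine ⟨N, hN, hNH, hNb, ⟨?_⟩⟩
  -- whiskering by the (fully faithful) inclusion reflects isomorphisms; `cosetSystem = relCosetSystem ⋙ incl.op`
  exact ((Functor.FullyFaithful.ofFullyFaithful (RelCosetCat.incl H).op).whiskeringRight ℕ).preimageIso
    (ι : c ⋙ (RelCosetCat.incl H).op ≅ relCosetSystem H N hN hNH ⋙ (RelCosetCat.incl H).op)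

include hG in
/-- **`Aut c ≃* Π` for every Galois cofinal system on the relative base `𝓑^temp(Π, Π°)⁰`.**
[cite: MochizukiSemiAnbd2006, Rmk 3.2.1 p.35] -/
theorem exists_mulEquiv_aut_relCoset (c : ℕ ⥤ (RelCosetCat H)ᵒᵖ)
    (htor : ∀ (k : ℕ) (S : RelCosetCat H) (ψ₁ ψ₂ : S ⟶ (c.obj k).unop), ∃ α : Aut (c.obj k).unop, ψ₁ = ψ₂ ≫ α.hom)
    (hcof : ∀ X : RelCosetCat H, ∃ k, Nonempty ((c.obj k).unop ⟶ X)) :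
    Nonempty (Aut c ≃* G) := by
  obtain ⟨N, hN, hNH, hNb, ⟨ι⟩⟩ := exists_iso_relCosetSystem H hG c htor hcof
  exact ⟨ι.conjAut.trans (toAutRelCosetMulEquiv H N hN hNH hG hNb).symm⟩


/-! ### `Ψ^Base` induces `Π₁ ≃* Π₂` on the small bases -/

section Transport

variable {G₂ : Type u} [Group G₂] [TopologicalSpace G₂] [IsTopologicalGroup G₂] (hG₂ : IsTempered G₂)

include hG hG₂ in
/-- **[FrdII] Thm. 2.4 (ii) on print's base `D = 𝓑^temp(Π, Π°)⁰` (small model `RelCosetCat Π°`):** an equivalence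
`Ψ^Base : RelCosetCat Π₁° ≌ RelCosetCat Π₂°` yields `Π₁ ≃* Π₂`. [cite: MochizukiFrdII2008, Thm 2.4 (ii) p.21] -/
theorem nonempty_mulEquiv_of_relCosetCat_equivalence [SecondCountableTopology G] (H₂ : OpenSubgroup G₂)
    (E : RelCosetCat H ≌ RelCosetCat H₂) : Nonempty (G ≃* G₂) := by
  obtain ⟨N, hN, hNb, hNH⟩ := exists_antitone_cofinal_seq_le H hG
  obtain ⟨N₂, hN₂, hNH₂, hN₂b, ⟨ι⟩⟩ := exists_iso_relCosetSystem H₂ hG₂ (relCosetSystem H N hN hNH ⋙ E.functor.op)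
    (fun k => torsor_functor_obj E (relCosetSystem_torsor H N hN hNH k))
    (cofinal_comp_equivalence E _ (relCosetSystem_cofinal H N hN hNH hNb))
  exact ⟨(toAutRelCosetMulEquiv H N hN hNH hG hNb).trans
    ((((Equivalence.congrRight (E := ℕ) E.op).fullyFaithfulFunctor.autMulEquivOfFullyFaithful
        (relCosetSystem H N hN hNH)).trans ι.conjAut).trans (toAutRelCosetMulEquiv H₂ N₂ hN₂ hNH₂ hG₂ hN₂b).symm)⟩

omit [IsTopologicalGroup G] in
include hG hG₂ in
/-- **Compatibility of the induced `Π₁ ≃* Π₂` with `Ψ^Base` on deck transformations**, on print's relative base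
`RelCosetCat Π°`: a straightening `ι` of the image system and `φ : Π₁ ≃* Π₂` with `r_{φ g} = ι⁻¹ ∘ Ψ^Base(r_g) ∘ ι`
(the `CosetCat` twin is `PadicFrobenioidPairIso`). [cite: MochizukiFrdII2008, Thm 2.4 (ii) p.21] -/
theorem exists_mulEquiv_compatible_of_relCosetCat_equivalence [SecondCountableTopology G] (H₂ : OpenSubgroup G₂)
    (E : RelCosetCat H ≌ RelCosetCat H₂) (hNb : ∀ U ∈ 𝓝 (1 : G), ∃ k, (N k : Set G) ⊆ U) :
    ∃ (N₂ : ℕ → OpenNormalSubgroup G₂) (hN₂ : Antitone N₂) (hNH₂ : ∀ k, (N₂ k).toOpenSubgroup ≤ H₂)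
      (_ : ∀ U ∈ 𝓝 (1 : G₂), ∃ k, (N₂ k : Set G₂) ⊆ U)
      (ι : relCosetSystem H N hN hNH ⋙ E.functor.op ≅ relCosetSystem H₂ N₂ hN₂ hNH₂) (φ : G ≃* G₂),
      ∀ g : G, toAutRelCosetMulEquiv H₂ N₂ hN₂ hNH₂ hG₂ ‹_› (φ g) =
        ι.conjAut ((Equivalence.congrRight (E := ℕ) E.op).functor.mapIso (toAutRelCosetMulEquiv H N hN hNH hG hNb g)) := by
  obtain ⟨N₂, hN₂, hNH₂, hN₂b, ⟨ι⟩⟩ := exists_iso_relCosetSystem H₂ hG₂ (relCosetSystem H N hN hNH ⋙ E.functor.op)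
    (fun k => torsor_functor_obj E (relCosetSystem_torsor H N hN hNH k))
    (cofinal_comp_equivalence E _ (relCosetSystem_cofinal H N hN hNH hNb))
  let e₂ : Aut (relCosetSystem H N hN hNH) ≃* Aut (relCosetSystem H N hN hNH ⋙ E.functor.op) :=
    (Equivalence.congrRight (E := ℕ) E.op).fullyFaithfulFunctor.autMulEquivOfFullyFaithful (relCosetSystem H N hN hNH)
  refine ⟨N₂, hN₂, hNH₂, hN₂b, ι, (toAutRelCosetMulEquiv H N hN hNH hG hNb).trans
    ((e₂.trans ι.conjAut).trans (toAutRelCosetMulEquiv H₂ N₂ hN₂ hNH₂ hG₂ hN₂b).symm), fun g => ?_⟩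
  change toAutRelCosetMulEquiv H₂ N₂ hN₂ hNH₂ hG₂ hN₂b ((toAutRelCosetMulEquiv H₂ N₂ hN₂ hNH₂ hG₂ hN₂b).symm
    (ι.conjAut (e₂ (toAutRelCosetMulEquiv H N hN hNH hG hNb g)))) = _
  rw [MulEquiv.apply_symm_apply]
  rfl

end Transport

end BaseGaloisSystem

end Literature.AlgebraicGeometry.Frobenioids

end
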